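import Literature.NumberTheory.Sieve.MoebiusShiftedPrimesRebalancedArcs
import Literature.NumberTheory.Sieve.MoebiusShiftedPrimesRebalancedMeanValue
import Literature.NumberTheory.Sieve.MoebiusShiftedPrimesAvgFinal
import HarnessLib

/-!
# Möbius on shifted primes — Theorem 2.2 of Lichtman 2020 AS PRINTED, from Lemma 4.5 and Lemma 4.8

Topic `Literature/NumberTheory/Sieve`.  This file closes the work on the named fact
`Literature.NumberTheory.Sieve.Lichtman2020_keyFourierEstimate` (J. D. Lichtman, *Averages of the
Möbius function on shifted primes*, Q. J. Math. 73 (2022) 729–757, doi:10.1093/qmath/haab054,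
arXiv:2009.08969v2 [Lichtman2020], Theorem 2.2, p. 7, along the PRINTED typical set `S(X,A,δ)` of
(2.3)–(2.4), in the regime `H ≤ exp((log X)^{2/3})` recorded at the fact) down to the two classical
inputs of the paper that the tree keeps as named facts:

* `Lichtman2020_keyFourierEstimate_of_primeCharacterSum_of_liouvilleCharacterSifted :
    Lichtman2020_primeCharacterSum → Lichtman2020_liouvilleCharacterSifted →
    Lichtman2020_keyFourierEstimate` (Lemma 4.5 = Vinogradov–Korobov for prime character sums,
  Lemma 4.8 = fundamental lemma + Siegel–Walfisz for `λχ`);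
* `Lichtman2020_keyFourierEstimate_of_primeCharacterSum_of_siegelWalfiszMoebius` (Lemma 4.8 being
  proved in the tree from the Siegel–Walfisz theorem for `μ`,
  `Lichtman2020_liouvilleCharacterSifted_of_siegelWalfiszMoebius`).

Everything here is PROVED; no definition, no new named fact.

## The repair of the printed argument (see also `MoebiusShiftedPrimesTypical.lean`)

The printed proof of Theorem 2.2 (§§2–5) does not close with the printed internal parameters: the
`E₁`-bound of Proposition 5.1 (p. 15) loses a factor `V ≍ (log X)^{B}`, and with `P₁ = (log X)^{33A}`
the first interval only affords a saving `(log X)^{-B}` with `3B + 1 ≤ 66αA`, `α < 1/4`, far from the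
printed `B = 11A` that the printed arcs (`|α - a/q| ≤ W⁴/(qH)`, `h ≥ H/W⁵`, `W = (log X)^A`) require.
The tree's answer (`MoebiusShiftedPrimesTypical.lean` … `MoebiusShiftedPrimesAvgFinal.lean`) enlarges
`P₁` to `(log X)^{100A}`, which changes the set `S` and hence the statement.  Here the STATEMENT is
kept and the internal parameters are re-balanced instead (`L = log X`):
moduli `d = e²`, `e ≤ ⌈L^{A/5}⌉` (`keyFourier_fixed_bound_M`); minor arcs with threshold
`W_m = L^{0.4A + 3/2}` and Dirichlet level `H/Θ`, `Θ = L^{0.8A + 2}` (`minorArc_sum_le_gen`: bound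
`600 HX log H/(d√W_m) ≤ 600 HX/(d L^{A/5})` as `log H ≤ L^{2/3}`); major arcs of width `Θ/(qH)` with
threshold `W_b = L^{A+2}` (`majorArc_fixed_bound_gen`: bound `≪ HXΘ/(dW_b) = HX/(dL^{A/5})` from
`J ≪ h²Y/W_b²` for `h ≥ H/W_b ≥ Q₁ = H/L^{4A}`); Proposition 3.4 with saving `W_b² = L^{2A+4}`
(`liouvilleMeanSquare_reb`, this file) from Proposition 5.1 with `B = 2A + 4`
(`dirichletMeanValue_reb`, `MoebiusShiftedPrimesRebalancedMeanValue.lean`) and Lemma 4.8 with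
`K = 13B/2`.  All constraints are met for every `A > 5` (in fact `A ≥ 4`).

## Content

* `Lichtman2020.liouvilleMeanSquare_reb` — Proposition 3.4 along the printed `S` with threshold
  `h ≥ H/(log X)^{A+2}` and saving `(log X)^{2A+4}`, from Lemma 4.5 and Lemma 4.8 (proof of p. 14 as in
  `Lichtman2020_liouvilleMeanSquareWith_of_dirichletMeanValueWith`, through
  `meanSquare_le_of_pieces_trunc`).
* the two assemblies displayed above.

## Source

* J. D. Lichtman, arXiv:2009.08969v2, Theorem 2.2 and §2 (pp. 7–8), §3 (pp. 9–11), §5 (pp. 14–15)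
  [Lichtman2020].
-/

noncomputable section

open Filter Asymptotics Finset MeasureTheory
open scoped FourierTransform Topology

namespace Literature.NumberTheory.Sieve.Lichtman2020

open ArithmeticFunction

/-! ### Parameter inequalities with free exponents -/

/-- Logarithms of the integer points of `[Y/2, 3Y]`, `Y ≥ X/(2ℓ^{y})`: `ℓ/2 ≤ log N ≤ 2ℓ`
(as `log_point_bounds`, free exponent). [folklore] -/
theorem log_point_bounds_gen {X y N : ℝ} (hX : 1 < X) (hℓ2 : 2 ≤ Real.log X)
    (hG : Real.log 2 + y * Real.log (Real.log X) ≤ Real.log X / 2)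
    (hN1 : X / (2 * Real.log X ^ y) ≤ N) (hN2 : N ≤ 3 * X) :
    Real.log X / 2 ≤ Real.log N ∧ Real.log N ≤ 2 * Real.log X := by
  have hX0 : 0 < X := by linarith
  have hℓ0 : 0 < Real.log X := by linarith
  have h6 : 0 < Real.log X ^ y := Real.rpow_pos_of_pos hℓ0 _
  have hN0 : 0 < N := lt_of_lt_of_le (by positivity) hN1
  constructor
  · have h1 : Real.log (X / (2 * Real.log X ^ y)) ≤ Real.log N := Real.log_le_log (by positivity) hN1
    rw [Real.log_div hX0.ne' (by positivity), Real.log_mul (by norm_num) h6.ne',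
      Real.log_rpow hℓ0] at h1
    linarith
  · have h1 : Real.log N ≤ Real.log (3 * X) := Real.log_le_log hN0 hN2
    rw [Real.log_mul (by norm_num) hX0.ne'] at h1
    have h3 : Real.log 3 ≤ 2 := by
      have := Real.log_le_sub_one_of_pos (by norm_num : (0 : ℝ) < 3); linarith
    linarith

/-- The Lemma-4.8 bound at the integer points of `[Y/2, 3Y]` with free exponents (as
`lemma48_at_points`: the hypotheses of Lemma 4.8 with `(2A, K)` for `(A, K)` are met there).
[cite: Lichtman2020, §5, proof of Proposition 3.4, (5.3)] -/
theorem lemma48_at_points_gen {c' A δ C₈ K y Y : ℝ} {X : ℕ} {H : ℕ → ℕ} {q : ℕ}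
    (χ : DirichletCharacter ℂ q) (hc' : 1 < c') (hA : 0 < A) (hδ : 0 < δ)
    (h8 : ∀ x : ℝ, 3 ≤ x → ∀ q : ℕ, 1 ≤ q → (q : ℝ) ≤ Real.log x ^ (2 * A) →
      ∀ χ : DirichletCharacter ℂ q, ∀ P : Finset ℕ,
        (∀ p ∈ P, p.Prime ∧ (q : ℝ) < p ∧ (p : ℝ) < x ^ (1 / Real.log (Real.log x))) →
        ‖∑ m ∈ (Icc 1 ⌊x⌋₊).filter (fun m => ∀ p ∈ P, ¬ p ∣ m),
            ((liouville m : ℤ) : ℂ) * χ (m : ZMod q)‖ ≤ C₈ * x / Real.log x ^ K)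
    (hX1 : (1 : ℝ) < X) (hℓ4 : 4 ≤ Real.log X) (hℓx₀ : 4 * 3 + 8 ≤ Real.log X)
    (hHX : (H X : ℝ) ≤ Real.exp (Real.log X ^ (2 / 3 : ℝ)))
    (hGa : Real.log 2 + y * Real.log (Real.log X) ≤ Real.log X / 2)
    (hGe : A * Real.log (Real.log X) + 1 ≤ Real.log X ^ (2 / 3 : ℝ))
    (hGf : 8 * Real.log (Real.log X) * Real.log X ^ (max (2 / 3 : ℝ) (1 - δ / 2)) < Real.log X)
    (hq : 1 ≤ q) (hqA : (q : ℝ) ≤ Real.log X ^ A)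
    (hY1 : (X : ℝ) / Real.log X ^ y ≤ Y) (hY2 : Y ≤ X) (hYℓ : Real.log X / 2 ≤ Y) :
    ∀ N : ℕ, Y / 2 ≤ N → (N : ℝ) ≤ 3 * Y → ∀ P : Finset ℕ,
      P ⊆ IntervalSieve.primesIcc (Real.log X ^ (c' * A)) ((H X : ℝ) / Real.log X ^ (4 * A))
        ∪ IntervalSieve.primesIcc (Real.exp (Real.log X ^ (2 / 3 + δ / 2)))
          (Real.exp (Real.log X ^ (1 - δ / 2))) →
      ‖∑ m ∈ (Icc 1 N).filter (fun m => ∀ p ∈ P, ¬ p ∣ m),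
          ((liouville m : ℤ) : ℂ) * χ (m : ZMod q)‖ ≤ max C₈ 0 * N / Real.log N ^ K := by
  intro N hN1 hN2 P hP
  set ℓ := Real.log X with hℓdef
  have hℓ0 : 0 < ℓ := by linarith
  have hℓ1 : 1 < ℓ := by linarith
  have hX0 : (0 : ℝ) < X := by linarith
  have h6 : 0 < ℓ ^ y := Real.rpow_pos_of_pos hℓ0 _
  have hN1' : (X : ℝ) / (2 * Real.log X ^ y) ≤ N := by
    have : (X : ℝ) / (2 * Real.log X ^ y) = X / Real.log X ^ y / 2 := by
      rw [div_div, mul_comm]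
    rw [this]; linarith
  have hN2' : (N : ℝ) ≤ 3 * X := hN2.trans (by linarith)
  obtain ⟨hlo, hhi⟩ := log_point_bounds_gen hX1 (by linarith) hGa hN1' hN2'
  have hN0 : (0 : ℝ) < N := lt_of_lt_of_le (by linarith) hN1
  have hN3 : (3 : ℝ) ≤ N := by linarith
  have hq2 : (q : ℝ) ≤ Real.log N ^ (2 * A) := hqA.trans (rpow_le_rpow_log_point hℓ4 hA.le hlo)
  -- the sieving primes
  set E₀ := max (2 / 3 : ℝ) (1 - δ / 2) with hE₀
  have hexpE : ∀ {u : ℝ}, u ≤ E₀ → Real.exp (ℓ ^ u) ≤ Real.exp (ℓ ^ E₀) := fun hu =>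
    Real.exp_le_exp.2 (Real.rpow_le_rpow_of_exponent_le hℓ1.le hu)
  have hHE : (H X : ℝ) ≤ Real.exp (ℓ ^ E₀) := hHX.trans (hexpE (le_max_left _ _))
  have hqℓ : (q : ℝ) < ℓ ^ (c' * A) :=
    lt_of_le_of_lt hqA ((Real.rpow_lt_rpow_left_iff hℓ1).2 (by nlinarith))
  have hqP₂ : (q : ℝ) < Real.exp (ℓ ^ (2 / 3 + δ / 2)) := by
    refine lt_of_le_of_lt hqA ?_
    rw [Real.rpow_def_of_pos hℓ0, Real.exp_lt_exp]
    have h1 : ℓ ^ (2 / 3 : ℝ) ≤ ℓ ^ (2 / 3 + δ / 2) :=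
      Real.rpow_le_rpow_of_exponent_le hℓ1.le (by linarith)
    nlinarith
  have hPcond : ∀ p ∈ P, p.Prime ∧ (q : ℝ) < p ∧ (p : ℝ) < (N : ℝ) ^ (1 / Real.log (Real.log N)) := by
    intro p hp
    have hp' := hP hp
    rw [Finset.mem_union, IntervalSieve.mem_primesIcc, IntervalSieve.mem_primesIcc] at hp'
    rcases hp' with ⟨hpr, hP1, hQ1⟩ | ⟨hpr, hP2, hQ2⟩
    · refine ⟨hpr, hqℓ.trans_le hP1, lt_rpow_inv_loglog hℓ4 hN0 hlo hhi ?_ hGf⟩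
      have h4 : 1 ≤ ℓ ^ (4 * A) := Real.one_le_rpow hℓ1.le (by positivity)
      have hH0 : (0 : ℝ) ≤ H X := Nat.cast_nonneg _
      exact hQ1.trans ((div_le_self hH0 h4).trans hHE)
    · exact ⟨hpr, hqP₂.trans_le hP2,
        lt_rpow_inv_loglog hℓ4 hN0 hlo hhi (hQ2.trans (hexpE (le_max_right _ _))) hGf⟩
  have key := h8 N hN3 q hq hq2 χ P hPcond
  rw [Nat.floor_natCast] at key
  refine key.trans ?_
  have hK0 : 0 ≤ Real.log N ^ K := Real.rpow_nonneg (by linarith) _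
  exact div_le_div_of_nonneg_right (mul_le_mul_of_nonneg_right (le_max_left _ _) hN0.le) hK0

/-- `h ≤ h₂ = Y/T₀³`, `T₀ = ℓ^{b}`: from `h ≤ H ≤ exp(ℓ^{2/3})`, `Y ≥ X/ℓ^{c}`,
`ℓ^{2/3} + (c + 3b) log ℓ ≤ ℓ` (as `h_le_h₂`, free exponents). [folklore] -/
theorem h_le_h₂_gen {X ℓ b c Hx h Y : ℝ} (hX : Real.exp ℓ = X) (hℓ : 1 ≤ ℓ) (hh : h ≤ Hx)
    (hHx : Hx ≤ Real.exp (ℓ ^ (2 / 3 : ℝ))) (hY : X / ℓ ^ c ≤ Y)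
    (hG : ℓ ^ (2 / 3 : ℝ) + (c + 3 * b) * Real.log ℓ ≤ ℓ) : h ≤ Y / (ℓ ^ b) ^ 3 := by
  have hℓ0 : 0 < ℓ := by linarith
  have e1 : (ℓ ^ b) ^ 3 = ℓ ^ (3 * b) := by
    rw [← Real.rpow_natCast, ← Real.rpow_mul hℓ0.le]; ring_nf
  have h3b : 0 < ℓ ^ (3 * b) := Real.rpow_pos_of_pos hℓ0 _
  rw [e1]
  have h1 : X / ℓ ^ c / ℓ ^ (3 * b) ≤ Y / ℓ ^ (3 * b) :=
    div_le_div_of_nonneg_right hY h3b.le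
  refine le_trans ?_ h1
  rw [div_div, ← Real.rpow_add hℓ0, div_rpow_log_eq_exp hX hℓ0]
  exact hh.trans (hHx.trans (Real.exp_le_exp.2 (by linarith)))

/-- `T₀ = ℓ^{b} ≤ Y/h`: from `h ≤ exp(ℓ^{2/3})`, `Y ≥ X/ℓ^{c}`, `ℓ^{2/3} + (c + b) log ℓ ≤ ℓ`
(as `T₀_le_U`, free exponents). [folklore] -/
theorem T₀_le_U_gen {X ℓ b c Hx h Y : ℝ} (hX : Real.exp ℓ = X) (hℓ : 1 ≤ ℓ) (hh0 : 0 < h)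
    (hh : h ≤ Hx) (hHx : Hx ≤ Real.exp (ℓ ^ (2 / 3 : ℝ))) (hY : X / ℓ ^ c ≤ Y)
    (hG : ℓ ^ (2 / 3 : ℝ) + (c + b) * Real.log ℓ ≤ ℓ) : ℓ ^ b ≤ Y / h := by
  have hℓ0 : 0 < ℓ := by linarith
  have hc0 : 0 < ℓ ^ c := Real.rpow_pos_of_pos hℓ0 _
  have hX0 : 0 < X := by rw [← hX]; exact Real.exp_pos _
  have hE : h ≤ Real.exp (ℓ ^ (2 / 3 : ℝ)) := hh.trans hHx
  have h1 : X / ℓ ^ c / Real.exp (ℓ ^ (2 / 3 : ℝ)) ≤ Y / h := by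
    calc X / ℓ ^ c / Real.exp (ℓ ^ (2 / 3 : ℝ)) ≤ Y / Real.exp (ℓ ^ (2 / 3 : ℝ)) :=
          div_le_div_of_nonneg_right hY (Real.exp_pos _).le
      _ ≤ Y / h := div_le_div_of_nonneg_left (by
          have : 0 < X / ℓ ^ c := by positivity
          linarith) hh0 hE
  refine le_trans ?_ h1
  rw [div_rpow_log_eq_exp hX hℓ0, ← Real.exp_sub, Real.rpow_def_of_pos hℓ0]
  have e : (c + b) * Real.log ℓ = c * Real.log ℓ + b * Real.log ℓ := by ring
  exact Real.exp_le_exp.2 (by nlinarith)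

/-- `√Y ≤ Y/h`: from `h ≤ exp(ℓ^{2/3})`, `Y ≥ X/ℓ^{c}`, `log 2 + 2ℓ^{2/3} + c log ℓ ≤ ℓ`
(as `sqrt_le_U'`, free exponent). [folklore] -/
theorem sqrt_le_U_gen {X ℓ c Hx h Y : ℝ} (hX : Real.exp ℓ = X) (hℓ : 1 ≤ ℓ) (hh0 : 0 < h)
    (hh : h ≤ Hx) (hHx : Hx ≤ Real.exp (ℓ ^ (2 / 3 : ℝ))) (hY : X / ℓ ^ c ≤ Y)
    (hG : Real.log 2 + 2 * ℓ ^ (2 / 3 : ℝ) + c * Real.log ℓ ≤ ℓ) :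
    Y ^ (1 / 2 : ℝ) ≤ Y / h := by
  have hℓ0 : 0 < ℓ := by linarith
  have h6 : 0 < ℓ ^ c := Real.rpow_pos_of_pos hℓ0 _
  have hX0 : 0 < X := by rw [← hX]; exact Real.exp_pos _
  have hY0 : 0 < Y := lt_of_lt_of_le (by positivity) hY
  -- `2 h² ≤ Y`
  have hE : h ≤ Real.exp (ℓ ^ (2 / 3 : ℝ)) := hh.trans hHx
  have h2 : 2 * h ^ 2 ≤ Y := by
    have h3 : 2 * h ^ 2 ≤ 2 * Real.exp (ℓ ^ (2 / 3 : ℝ)) ^ 2 := by gcongr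
    refine h3.trans (le_trans ?_ hY)
    rw [div_rpow_log_eq_exp hX hℓ0, ← Real.exp_nat_mul,
      show (2 : ℝ) = Real.exp (Real.log 2) by rw [Real.exp_log (by norm_num)], ← Real.exp_add,
      Real.exp_log (by norm_num)]
    exact Real.exp_le_exp.2 (by push_cast; linarith)
  -- `√Y ≤ √(2Y) ≤ Y/h`
  have hU0 : 0 ≤ Y / h := by positivity
  have hsq : (2 * Y) ^ (1 / 2 : ℝ) ≤ Y / h := by
    rw [← pow_le_pow_iff_left₀ (Real.rpow_nonneg (by positivity) _) hU0 two_ne_zero,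
      ← Real.rpow_natCast, ← Real.rpow_mul (by positivity)]
    norm_num
    rw [div_pow, le_div_iff₀ (by positivity)]
    nlinarith
  exact (Real.rpow_le_rpow hY0.le (by linarith) (by norm_num)).trans hsq

/-- (n5) The long-window term with free saving: for `T₀ = ℓ^{2B}`, `h₂ = Y/T₀³`, `K = 13B/2`,
`η = 24 C₈ Y/(ℓ/2)^{K}`: `2 (h/h₂)² η² Y = 2 (24 C₈ 2^{K})² h² Y ℓ^{-B}`. [folklore] -/
theorem numerics_eta_gen {ℓ B C₈ h Y : ℝ} (hℓ : 1 ≤ ℓ) (hY : 0 < Y) :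
    2 * (h / (Y / (ℓ ^ (2 * B)) ^ 3)) ^ 2 * (24 * C₈ * Y / (ℓ / 2) ^ (13 * B / 2)) ^ 2 * Y =
      2 * (24 * C₈ * 2 ^ (13 * B / 2)) ^ 2 * (h ^ 2 * Y * (1 / ℓ ^ B)) := by
  have hℓ0 : 0 < ℓ := by linarith
  have e1 : (ℓ ^ (2 * B)) ^ 3 = ℓ ^ (6 * B) := by
    rw [← Real.rpow_natCast, ← Real.rpow_mul hℓ0.le]; ring_nf
  have e2 : (ℓ / 2) ^ (13 * B / 2) = ℓ ^ (13 * B / 2) / 2 ^ (13 * B / 2) :=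
    Real.div_rpow hℓ0.le (by norm_num) _
  have h6 : 0 < ℓ ^ (6 * B) := Real.rpow_pos_of_pos hℓ0 _
  have h13 : 0 < ℓ ^ (13 * B / 2) := Real.rpow_pos_of_pos hℓ0 _
  have hB' : 0 < ℓ ^ B := Real.rpow_pos_of_pos hℓ0 _
  have h2 : (0 : ℝ) < 2 ^ (13 * B / 2) := Real.rpow_pos_of_pos (by norm_num) _
  have e3 : (ℓ ^ (6 * B)) ^ 2 * ℓ ^ B = (ℓ ^ (13 * B / 2)) ^ 2 := by
    rw [← Real.rpow_natCast, ← Real.rpow_natCast (ℓ ^ (13 * B / 2)), ← Real.rpow_mul hℓ0.le,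
      ← Real.rpow_mul hℓ0.le, ← Real.rpow_add hℓ0]
    ring_nf
  rw [e1, e2]
  field_simp
  rw [show B * 13 / 2 = 13 * B / 2 by ring, ← e3]
  ring

end Literature.NumberTheory.Sieve.Lichtman2020

namespace Literature.NumberTheory.Sieve.Lichtman2020

open ArithmeticFunction

/-! ### Proposition 3.4 along the printed set, re-balanced -/

-- The assembly below is long but linear (ten filters, two piece bounds, numerics).
set_option maxHeartbeats 800000 in
/-- **Lichtman 2020, Proposition 3.4 along the PRINTED set `S(X,A,δ)`, re-balanced** ("Proof of
Proposition 3.4 from Proposition 5.1", p. 14): from a Proposition-5.1 bound with saving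
`(log X)^{-(2A+4)}` (the shape of `dirichletMeanValue_reb`) and Lemma 4.8
(`Lichtman2020_liouvilleCharacterSifted`), for `A > 5`, `δ > 0`, `H` in the regime, eventually in `X`:
for `q ≤ (log X)^A`, `χ (mod q)`, `h ∈ [H/(log X)^{A+2}, H]`, `Y ∈ [X/(log X)^{2A+4}, X]`,
`∫_Y^{2Y} |∑_{x ≤ m ≤ x+h, m ∈ S} λ(m)χ(m)|² dx ≤ C h²Y/(log X)^{2A+4}`.  With `ℓ = log X`, `B = 2A+4`,
`T₀ = ℓ^{2B}`, `h₂ = Y/T₀³`, `K = 13B/2`: the long windows are `≤ η = 24C₈Y/(ℓ/2)^K`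
(`norm_longWindow_le`, `lemma48_at_points_gen`), the two Proposition-5.1 bounds (for `χ`, `χ⁻¹` at the
scale `Y`) feed `meanSquare_le_of_pieces_trunc`, and `Q₁/h ≤ 1`, `h ≥ ℓ^B`, `Y ≥ ℓ^B` give the constant
`24·2431²(4004 + 72C₅) + 2(24C₈2^{K})²`. [cite: Lichtman2020, Proposition 3.4] -/
theorem liouvilleMeanSquare_reb_of
    (h51 : ∀ A : ℝ, 5 < A → ∀ δ : ℝ, 0 < δ → ∀ H : ℕ → ℕ,
      Tendsto (fun X : ℕ => Real.log (H X) / Real.log (Real.log X)) atTop atTop →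
      (∀ᶠ X : ℕ in atTop, (H X : ℝ) ≤ Real.exp (Real.log X ^ (2 / 3 : ℝ))) →
      ∃ C : ℝ, ∀ᶠ X : ℕ in atTop, ∀ q : ℕ, 1 ≤ q → (q : ℝ) ≤ Real.log X ^ A →
        ∀ χ : DirichletCharacter ℂ q, ∀ Y : ℝ, (X : ℝ) / Real.log X ^ (2 * A + 4) ≤ Y →
          Y ≤ 2 * X → ∀ T : ℝ, 0 ≤ T → T ≤ 2 * X →
            ∫ t in (Real.log X ^ (2 * (2 * A + 4)))..T,
                ‖∑ n ∈ (Icc ⌈Y⌉₊ ⌊2 * Y⌋₊).filter (lichtmanTypical X A δ (H X)),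
                    ((liouville n : ℤ) : ℂ) * χ (n : ZMod q) *
                      (n : ℂ) ^ (-(1 + (t : ℂ) * Complex.I))‖ ^ 2
              ≤ C * (((H X : ℝ) / Real.log X ^ (4 * A)) * T / Y + 1) / Real.log X ^ (2 * A + 4))
    (h48 : Lichtman2020_liouvilleCharacterSifted) :
    ∀ A : ℝ, 5 < A → ∀ δ : ℝ, 0 < δ → ∀ H : ℕ → ℕ,
    Tendsto (fun X : ℕ => Real.log (H X) / Real.log (Real.log X)) atTop atTop →
    (∀ᶠ X : ℕ in atTop, (H X : ℝ) ≤ Real.exp (Real.log X ^ (2 / 3 : ℝ))) →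
    ∃ C : ℝ, ∀ᶠ X : ℕ in atTop, ∀ q : ℕ, 1 ≤ q → (q : ℝ) ≤ Real.log X ^ A →
      ∀ χ : DirichletCharacter ℂ q, ∀ h : ℕ,
        (H X : ℝ) / Real.log X ^ (A + 2) ≤ h → h ≤ H X →
        ∀ Y : ℝ, (X : ℝ) / Real.log X ^ (2 * A + 4) ≤ Y → Y ≤ X →
          ∫ x in Y..2 * Y,
              ‖∑ m ∈ (Icc ⌈x⌉₊ ⌊x + h⌋₊).filter (lichtmanTypical X A δ (H X)),
                  ((liouville m : ℤ) : ℂ) * χ (m : ZMod q)‖ ^ 2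
            ≤ C * ((h : ℝ) ^ 2 * Y / Real.log X ^ (2 * A + 4)) := by
  intro A hA δ hδ H hH hHexp
  have hA0 : 0 < A := by linarith
  obtain ⟨C₅, h5⟩ := h51 A hA δ hδ H hH hHexp
  set B : ℝ := 2 * A + 4 with hBdef
  have hB0 : 0 < B := by rw [hBdef]; linarith
  have hK0 : 0 < 13 * B / 2 := by positivity
  obtain ⟨C₈, h8⟩ := h48 (2 * A) (13 * B / 2) (by linarith) hK0
  have hC₅'0 : 0 ≤ max C₅ 0 := le_max_right _ _
  have hC₈'0 : 0 ≤ max C₈ 0 := le_max_right _ _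
  have hE₀1 : max (2 / 3 : ℝ) (1 - δ / 2) < 1 := max_lt (by norm_num) (by linarith)
  refine ⟨24 * 2431 ^ 2 * (4004 + 72 * max C₅ 0) + 2 * (24 * max C₈ 0 * 2 ^ (13 * B / 2)) ^ 2, ?_⟩
  filter_upwards [h5, hHexp, eventually_rpow_log_le_H hH (A + 2 + B),
    eventually_small_terms (Real.log 2) B (show (1 / 2 : ℝ) < 1 by norm_num)
      (show (1 / 2 : ℝ) < 1 by norm_num) (show (0 : ℝ) < 1 / 2 by norm_num),
    eventually_small_terms 0 (7 * B) (show (2 / 3 : ℝ) < 1 by norm_num)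
      (show (2 / 3 : ℝ) < 1 by norm_num) one_pos,
    eventually_small_terms (Real.log 2) B (show (2 / 3 : ℝ) < 1 by norm_num)
      (show (2 / 3 : ℝ) < 1 by norm_num) one_pos,
    eventually_cond_e hA0, eventually_cond_f hE₀1,
    tendsto_log_natCast.eventually_ge_atTop (4 * 3 + 8), eventually_ge_atTop 3]
    with X h5X hHX hHlow hGa hG7 hGd hGe hGf hℓbig hX3
  intro q hq hqA χ h hh1 hh2 Y hY1 hY2
  -- the scale `ℓ = log X`
  set ℓ := Real.log X with hℓdef
  have hℓ4 : 4 ≤ ℓ := by linarith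
  have hℓ1 : 1 ≤ ℓ := by linarith
  have hℓ0 : 0 < ℓ := by linarith
  have hX3' : (3 : ℝ) ≤ X := by exact_mod_cast hX3
  have hX0 : (0 : ℝ) < X := by linarith
  have hX1 : (1 : ℝ) < X := by linarith
  have hXexp : Real.exp ℓ = X := Real.exp_log hX0
  have hlogℓ0 : 0 ≤ Real.log ℓ := Real.log_nonneg hℓ1
  -- clean forms of the growth conditions
  have hGa' : Real.log 2 + B * Real.log ℓ ≤ ℓ / 2 := by
    have : 0 ≤ ℓ ^ (1 / 2 : ℝ) := Real.rpow_nonneg hℓ0.le _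
    linarith
  have hG7' : ℓ ^ (2 / 3 : ℝ) + 7 * B * Real.log ℓ ≤ ℓ := by
    have : 0 ≤ ℓ ^ (2 / 3 : ℝ) := Real.rpow_nonneg hℓ0.le _
    linarith
  have hGd' : Real.log 2 + 2 * ℓ ^ (2 / 3 : ℝ) + B * Real.log ℓ ≤ ℓ := by linarith
  -- `H`, `h`
  have hpowA2 : 0 < ℓ ^ (A + 2) := Real.rpow_pos_of_pos hℓ0 _
  have hHx0 : (0 : ℝ) < H X := lt_of_lt_of_le (Real.rpow_pos_of_pos hℓ0 _) hHlow
  have hh2r : (h : ℝ) ≤ H X := by exact_mod_cast hh2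
  have hhB : ℓ ^ B ≤ h := by
    refine le_trans ?_ hh1
    rw [le_div_iff₀ hpowA2, ← Real.rpow_add hℓ0]
    have : B + (A + 2) = A + 2 + B := by ring
    rw [this]; exact hHlow
  have hℓB1 : 1 ≤ ℓ ^ B := Real.one_le_rpow hℓ1 hB0.le
  have hℓB0 : 0 < ℓ ^ B := by linarith
  have hh1' : (1 : ℝ) ≤ h := hℓB1.trans hhB
  have hh0 : (0 : ℝ) < h := by linarith
  -- `Y`
  have hYℓ : ℓ / 2 ≤ Y := by
    have e := div_rpow_log_eq_exp hXexp hℓ0 (c := B)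
    have h1 : ℓ - B * Real.log ℓ + 1 ≤ Real.exp (ℓ - B * Real.log ℓ) :=
      Real.add_one_le_exp (ℓ - B * Real.log ℓ)
    have h2 : (0 : ℝ) ≤ Real.log 2 := Real.log_nonneg (by norm_num)
    rw [← e] at h1
    linarith
  have hY2' : 2 ≤ Y := by linarith
  have hY1' : 1 ≤ Y := by linarith
  have hY0 : 0 < Y := by linarith
  -- `T₀`, `h₂`, `U`
  have hT₀1 : 1 ≤ ℓ ^ (2 * B) := Real.one_le_rpow hℓ1 (by linarith)
  have hhh₂ : (h : ℝ) ≤ Y / (ℓ ^ (2 * B)) ^ 3 :=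
    h_le_h₂_gen hXexp hℓ1 hh2r hHX hY1 (by
      have : (B + 3 * (2 * B)) * Real.log ℓ = 7 * B * Real.log ℓ := by ring
      linarith)
  have hh₂0 : 0 ≤ Y / (ℓ ^ (2 * B)) ^ 3 := by positivity
  have hh₂Y : Y / (ℓ ^ (2 * B)) ^ 3 ≤ Y := div_le_self hY0.le (one_le_pow₀ hT₀1)
  have hT₀U : ℓ ^ (2 * B) ≤ Y / h :=
    T₀_le_U_gen hXexp hℓ1 hh0 hh2r hHX hY1 (by
      have : (B + 2 * B) * Real.log ℓ ≤ 7 * B * Real.log ℓ := by nlinarith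
      linarith)
  have hU : Y ^ (1 / 2 : ℝ) ≤ Y / h := sqrt_le_U_gen hXexp hℓ1 hh0 hh2r hHX hY1 hGd'
  have hQ0 : (0 : ℝ) ≤ H X / ℓ ^ (4 * A) := by positivity
  have hL0 : (0 : ℝ) ≤ 1 / ℓ ^ B := by positivity
  have hη0 : 0 ≤ 24 * max C₈ 0 * Y / (ℓ / 2) ^ (13 * B / 2) := by positivity
  -- the long windows ((5.3))
  have h8' := lemma48_at_points_gen (c' := 33) (y := B) (K := 13 * B / 2) χ (by norm_num) hA0 hδ h8
    hX1 hℓ4 hℓbig hHX hGa' hGe hGf hq hqA hY1 hY2 hYℓ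
  have hlogN : ∀ N : ℕ, Y / 2 ≤ N → (N : ℝ) ≤ 3 * Y → ℓ / 2 ≤ Real.log N := by
    intro N hN1 hN2
    have hN1' : (X : ℝ) / (2 * Real.log X ^ B) ≤ N := by
      have : (X : ℝ) / (2 * Real.log X ^ B) = X / Real.log X ^ B / 2 := by
        rw [div_div, mul_comm]
      rw [this]; linarith
    exact (log_point_bounds_gen hX1 (by linarith) hGa' hN1' (hN2.trans (by linarith))).1
  have hS₂ : ∀ x ∈ Set.Icc Y (2 * Y),
      ‖∑ m ∈ (Finset.Icc ⌈x⌉₊ ⌊x + Y / (ℓ ^ (2 * B)) ^ 3⌋₊).filter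
        (lichtmanTypical X A δ (H X)),
        ((liouville m : ℤ) : ℂ) * χ (m : ZMod q)‖ ≤ 24 * max C₈ 0 * Y / (ℓ / 2) ^ (13 * B / 2) := by
    intro x hx
    exact norm_longWindow_le (c' := 33) χ hY2' hh₂0 hh₂Y hx hC₈'0 hK0.le (by linarith) hlogN h8'
  -- the two Proposition-5.1 bounds at the scale `Y`
  have hY2X : Y ≤ 2 * (X : ℝ) := by linarith
  haveI : NeZero q := ⟨by omega⟩
  have hP₁ : DirichletPieceBound (lichtmanTypical X A δ (H X))
      (fun n => ((liouville n : ℤ) : ℂ) * χ (n : ZMod q)) Y (ℓ ^ (2 * B)) (max C₅ 0)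
      (H X / ℓ ^ (4 * A)) (1 / ℓ ^ B) :=
    pieceBound_of_prop51 hℓB0 hY0 hY2X hQ0 fun T hT1 hT2 => h5X q hq hqA χ Y hY1 hY2X T hT1 hT2
  have hP₃ : DirichletPieceBound (lichtmanTypical X A δ (H X))
      (fun n => star (((liouville n : ℤ) : ℂ) * χ (n : ZMod q))) Y (ℓ ^ (2 * B)) (max C₅ 0)
      (H X / ℓ ^ (4 * A)) (1 / ℓ ^ B) := by
    rw [star_liouville_mul_char χ]
    exact pieceBound_of_prop51 hℓB0 hY0 hY2X hQ0
      fun T hT1 hT2 => h5X q hq hqA χ⁻¹ Y hY1 hY2X T hT1 hT2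
  -- the skeleton
  have main := meanSquare_le_of_pieces_trunc (lichtmanTypical X A δ (H X))
    (c := fun n => ((liouville n : ℤ) : ℂ) * χ (n : ZMod q)) (norm_liouville_mul_char_le χ)
    hY1' hT₀1 hh1' hhh₂ le_rfl hη0 hC₅'0 hQ0 hL0 hT₀U hU hS₂ hP₁ hP₃
  refine main.trans ?_
  -- numerics
  have hX2B : ℓ ^ (2 * B) ≤ X := by
    refine rpow_log_le_self hXexp hℓ0 ?_
    have h2 : 0 ≤ ℓ ^ (2 / 3 : ℝ) := Real.rpow_nonneg hℓ0.le _
    nlinarith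
  have hn1 : 2000 / (ℓ ^ (2 * B)) ^ 2 ≤ 2000 * (1 / ℓ ^ B) := by
    rw [mul_one_div]
    apply div_le_div_of_nonneg_left (by norm_num) hℓB0
    calc ℓ ^ B ≤ ℓ ^ (2 * B) := Real.rpow_le_rpow_of_exponent_le hℓ1 (by linarith)
      _ ≤ (ℓ ^ (2 * B)) ^ 2 := by
          have h1 : 1 ≤ ℓ ^ (2 * B) := hT₀1
          nlinarith
  have hn2 : 36 * max C₅ 0 * (H X / ℓ ^ (4 * A) / h + 1) * (1 / ℓ ^ B) ≤
      72 * max C₅ 0 * (1 / ℓ ^ B) := by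
    have hQh : (H X : ℝ) / ℓ ^ (4 * A) / h ≤ 1 := by
      rw [div_le_one hh0]
      refine le_trans ?_ hh1
      apply div_le_div_of_nonneg_left hHx0.le hpowA2
      exact Real.rpow_le_rpow_of_exponent_le hℓ1 (by linarith)
    have h36 : 36 * max C₅ 0 * (H X / ℓ ^ (4 * A) / h + 1) ≤ 36 * max C₅ 0 * 2 := by
      apply mul_le_mul_of_nonneg_left _ (by positivity); linarith
    have := mul_le_mul_of_nonneg_right h36 hL0
    linarith
  have hn3 : 2000 / (h : ℝ) ≤ 2000 * (1 / ℓ ^ B) := by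
    rw [mul_one_div]; exact div_le_div_of_nonneg_left (by norm_num) hℓB0 hhB
  have hn4 : 4 / Y ≤ 4 * (1 / ℓ ^ B) := by
    rw [mul_one_div]
    apply div_le_div_of_nonneg_left (by norm_num) hℓB0
    refine le_trans ?_ hY1
    rw [le_div_iff₀ hℓB0, ← Real.rpow_add hℓ0]
    have : B + B = 2 * B := by ring
    rw [this]; exact hX2B
  rw [numerics_eta_gen hℓ1 hY0]
  have hsum : 2000 / (ℓ ^ (2 * B)) ^ 2 + 36 * max C₅ 0 * (H X / ℓ ^ (4 * A) / h + 1) * (1 / ℓ ^ B)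
      + 2000 / h + 4 / Y ≤ (4004 + 72 * max C₅ 0) * (1 / ℓ ^ B) := by
    linarith
  have hpre : 0 ≤ 24 * 2431 ^ 2 * (h : ℝ) ^ 2 * Y := by positivity
  have h1 := mul_le_mul_of_nonneg_left hsum hpre
  have e : (h : ℝ) ^ 2 * Y / ℓ ^ B = (h : ℝ) ^ 2 * Y * (1 / ℓ ^ B) := by
    rw [mul_one_div]
  rw [e]
  linarith [h1]

end Literature.NumberTheory.Sieve.Lichtman2020

namespace Literature.NumberTheory.Sieve

open Lichtman2020 ArithmeticFunction

-- The final assembly: two arcs, the per-modulus bound, the sum over the moduli; long but linear.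
set_option maxHeartbeats 1600000 in
/-- **Lichtman 2020, Theorem 2.2 AS PRINTED (the named fact `Lichtman2020_keyFourierEstimate`), from a
Proposition-5.1 bound of saving `(log X)^{-(2A+4)}` along the printed set and Lemma 4.8.**  For each
`X` (large), `α`, write the integral as `∑_{k ≤ X}` (`integral_window_eq_sum`) and apply
`keyFourier_fixed_bound_M` with the moduli `e ≤ M = ⌈L^{A/5}⌉` (`L = log X`): for `d = e²` and any
`β`, reduce to `β ∈ [0,1] = 𝔐 ∪ 𝔪` for the arcs of threshold `W_m = L^{0.4A+3/2}` and level `H/Θ`,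
`Θ = L^{0.8A+2}`; on `𝔪`, `minorArc_sum_le_gen` gives `600 HX log H/(d√W_m) ≤ 600 HX/(dL^{A/5})`; on
`𝔐`, `majorArc_fixed_bound_gen` with `W_b = L^{A+2}` and the mean square `liouvilleMeanSquare_reb_of`
(for the moduli `q/c ≤ W_m ≤ L^A`, `h ∈ [H/W_b, H]`, `Y ∈ [X/(dW_b), X] ⊆ [X/L^{2A+4}, X]`) gives
`C' HXΘ/(dW_b) = C' HX/(dL^{A/5})`; finally `∑_e e⁻² ≤ 2` and the tail `2HX/M ≤ 2HX/L^{A/5}`.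
[cite: Lichtman2020, Theorem 2.2] -/
theorem Lichtman2020_keyFourierEstimate_of_dirichletMeanValue_reb_of_liouvilleCharacterSifted
    (h51 : ∀ A : ℝ, 5 < A → ∀ δ : ℝ, 0 < δ → ∀ H : ℕ → ℕ,
      Tendsto (fun X : ℕ => Real.log (H X) / Real.log (Real.log X)) atTop atTop →
      (∀ᶠ X : ℕ in atTop, (H X : ℝ) ≤ Real.exp (Real.log X ^ (2 / 3 : ℝ))) →
      ∃ C : ℝ, ∀ᶠ X : ℕ in atTop, ∀ q : ℕ, 1 ≤ q → (q : ℝ) ≤ Real.log X ^ A →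
        ∀ χ : DirichletCharacter ℂ q, ∀ Y : ℝ, (X : ℝ) / Real.log X ^ (2 * A + 4) ≤ Y →
          Y ≤ 2 * X → ∀ T : ℝ, 0 ≤ T → T ≤ 2 * X →
            ∫ t in (Real.log X ^ (2 * (2 * A + 4)))..T,
                ‖∑ n ∈ (Icc ⌈Y⌉₊ ⌊2 * Y⌋₊).filter (lichtmanTypical X A δ (H X)),
                    ((liouville n : ℤ) : ℂ) * χ (n : ZMod q) *
                      (n : ℂ) ^ (-(1 + (t : ℂ) * Complex.I))‖ ^ 2
              ≤ C * (((H X : ℝ) / Real.log X ^ (4 * A)) * T / Y + 1) / Real.log X ^ (2 * A + 4))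
    (h48 : Lichtman2020_liouvilleCharacterSifted) :
    Lichtman2020_keyFourierEstimate := by
  intro A hA δ hδ H hH hHexp
  have hA0 : 0 < A := by linarith
  obtain ⟨C, hC⟩ := liouvilleMeanSquare_reb_of h51 h48 A hA δ hδ H hH hHexp
  obtain ⟨C', hC'def⟩ : ∃ C' : ℝ, C' = max C 0 := ⟨_, rfl⟩
  have hC'0 : 0 ≤ C' := by rw [hC'def]; exact le_max_right _ _
  have hCC' : C ≤ C' := by rw [hC'def]; exact le_max_left _ _
  obtain ⟨Cmaj, hCmaj⟩ : ∃ Cmaj : ℝ, Cmaj = 2 * (6 + 12 * Real.sqrt C') +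
      2 * Real.pi * (6 + 12 * Real.sqrt C') + 8 * Real.pi := ⟨_, rfl⟩
  have hCmaj0 : 0 ≤ Cmaj := by rw [hCmaj]; positivity
  refine ⟨2 * (Cmaj + 600) + 2, ?_⟩
  have hP2ev : ∀ᶠ X : ℕ in atTop, Real.log X ^ A < Real.exp (Real.log X ^ (2 / 3 + δ / 2)) := by
    filter_upwards [eventually_sqrtW_lt_P2 (2 * A) δ hδ] with X hX
    rwa [show 2 * A / 2 = A by ring] at hX
  filter_upwards [hC, hHexp, eventually_one_le_H hH, eventually_three_le_H hH,
    eventually_rpow_log_le_H hH (2 * A + 5), eventually_rpow_log_le_natCast (2 * A + 5),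
    tendsto_log_natCast.eventually_ge_atTop (256 : ℝ), hP2ev, eventually_ge_atTop 1]
    with X hCX hHX h1 h3 hHbig hXbig hL64 hP2X hX1 α
  -- the scale
  set L : ℝ := Real.log X with hLdef
  have hL1 : 1 ≤ L := by linarith
  have hL1' : 1 < L := by linarith
  have hL0 : 0 < L := by linarith
  have hL16 : (16 : ℝ) ≤ L := by linarith
  have hX0 : (0 : ℝ) < X := by exact_mod_cast (show 0 < X by omega)
  have hH3 : (3 : ℝ) ≤ H X := by exact_mod_cast h3
  have hH0 : (0 : ℝ) < H X := by linarith
  have hHleX : H X ≤ X := by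
    have h2 : L ^ (2 / 3 : ℝ) ≤ L := by
      calc L ^ (2 / 3 : ℝ) ≤ L ^ (1 : ℝ) := Real.rpow_le_rpow_of_exponent_le hL1 (by norm_num)
        _ = L := Real.rpow_one _
    have h3' : (H X : ℝ) ≤ X := by
      calc (H X : ℝ) ≤ Real.exp (L ^ (2 / 3 : ℝ)) := hHX
        _ ≤ Real.exp L := Real.exp_le_exp.mpr h2
        _ = X := Real.exp_log hX0
    exact_mod_cast h3'
  have hlogH : Real.log (H X) ≤ L ^ (2 / 3 : ℝ) := by
    have := Real.log_le_log hH0 hHX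
    rwa [Real.log_exp] at this
  have hlogH0 : 0 ≤ Real.log (H X) := Real.log_nonneg (by linarith)
  -- monotonicity of powers of `L`
  have hmono : ∀ {u v : ℝ}, u ≤ v → L ^ u ≤ L ^ v := fun huv =>
    Real.rpow_le_rpow_of_exponent_le hL1 huv
  have hpos : ∀ u : ℝ, 0 < L ^ u := fun u => Real.rpow_pos_of_pos hL0 u
  -- the parameters
  obtain ⟨Wm, hWmdef⟩ : ∃ Wm : ℝ, Wm = L ^ (2 / 5 * A + 3 / 2) := ⟨_, rfl⟩
  obtain ⟨Θ, hΘdef⟩ : ∃ Θ : ℝ, Θ = L ^ (4 / 5 * A + 2) := ⟨_, rfl⟩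
  obtain ⟨Wb, hWbdef⟩ : ∃ Wb : ℝ, Wb = L ^ (A + 2) := ⟨_, rfl⟩
  obtain ⟨Lv, hLvdef⟩ : ∃ Lv : ℝ, Lv = (H X : ℝ) / Θ := ⟨_, rfl⟩
  have hWm0 : 0 < Wm := by rw [hWmdef]; exact hpos _
  have hΘ0 : 0 < Θ := by rw [hΘdef]; exact hpos _
  have hWb0 : 0 < Wb := by rw [hWbdef]; exact hpos _
  have hWm2 : 2 ≤ Wm := by
    rw [hWmdef]
    calc (2 : ℝ) ≤ L := by linarith
      _ = L ^ (1 : ℝ) := (Real.rpow_one L).symm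
      _ ≤ L ^ (2 / 5 * A + 3 / 2) := hmono (by linarith)
  have hWmA : Wm ≤ L ^ A := by rw [hWmdef]; exact hmono (by linarith)
  have hWmΘ : Wm ≤ Θ := by rw [hWmdef, hΘdef]; exact hmono (by linarith)
  have hWb4 : 4 ≤ Wb := by
    rw [hWbdef]
    calc (4 : ℝ) ≤ L := by linarith
      _ = L ^ (1 : ℝ) := (Real.rpow_one L).symm
      _ ≤ L ^ (A + 2) := hmono (by linarith)
  have hbig : L ^ (2 * A + 5) ≤ H X := hHbig
  have hΘH : Θ ≤ H X := by rw [hΘdef]; exact (hmono (by linarith)).trans hbig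
  have hLv1 : 1 ≤ Lv := by rw [hLvdef, le_div_iff₀ hΘ0, one_mul]; exact hΘH
  have hWb2 : Wb ^ 2 = L ^ (2 * A + 4) := by
    rw [hWbdef, ← Real.rpow_natCast, ← Real.rpow_mul hL0.le]; ring_nf
  have hWbH : Wb ^ 2 ≤ H X := by
    rw [hWb2]; exact (hmono (by linarith)).trans hbig
  have hΘWb : Θ * L ^ (A / 5) = Wb := by
    rw [hΘdef, hWbdef, ← Real.rpow_add hL0]; ring_nf
  have hL12 : (16 : ℝ) ≤ L ^ (1 / 2 : ℝ) := by
    have h := Real.rpow_le_rpow (by norm_num) (show (256 : ℝ) ≤ L by linarith)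
      (by norm_num : (0 : ℝ) ≤ 1 / 2)
    have e : (256 : ℝ) ^ (1 / 2 : ℝ) = 16 := by
      rw [show (256 : ℝ) = 16 ^ (2 : ℝ) by norm_num, ← Real.rpow_mul (by norm_num)]; norm_num
    linarith
  have hWmP1 : Wm < L ^ (33 * A) := by
    rw [hWmdef]; exact Real.rpow_lt_rpow_of_exponent_lt hL1' (by linarith)
  have hWmP2 : Wm < Real.exp (L ^ (2 / 3 + δ / 2)) := lt_of_le_of_lt hWmA hP2X
  have hP₁W : Wm ^ 33 ≤ L ^ (33 * A) := by
    have e : Wm ^ 33 = L ^ (33 * (2 / 5 * A + 3 / 2)) := by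
      rw [hWmdef, ← Real.rpow_natCast, ← Real.rpow_mul hL0.le]; ring_nf
    rw [e]; exact hmono (by linarith)
  have hQP : (H X : ℝ) / L ^ (4 * A) < Real.exp (L ^ (2 / 3 + δ / 2)) := by
    have h1' : (H X : ℝ) / L ^ (4 * A) ≤ H X :=
      div_le_self hH0.le (Real.one_le_rpow hL1 (by positivity))
    have h2 : (H X : ℝ) < Real.exp (L ^ (2 / 3 + δ / 2)) :=
      lt_of_le_of_lt hHX (Real.exp_lt_exp.mpr (Real.rpow_lt_rpow_of_exponent_lt hL1' (by linarith)))
    linarith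
  -- the moduli
  set M : ℕ := ⌈L ^ (A / 5)⌉₊ with hMdef
  have hM1 : 1 ≤ M := Nat.one_le_iff_ne_zero.mpr (Nat.ceil_pos.mpr (hpos _)).ne'
  have hMge : L ^ (A / 5) ≤ M := Nat.le_ceil _
  have hMle : (M : ℝ) ≤ 2 * L ^ (A / 5) := by
    have h1' := (Nat.ceil_lt_add_one (hpos (A / 5)).le).le
    have h2 : 1 ≤ L ^ (A / 5) := Real.one_le_rpow hL1 (by positivity)
    rw [hMdef]; linarith
  have hM0 : (0 : ℝ) < M := by exact_mod_cast (show 0 < M by omega)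
  -- sizes of the moduli `d = e²`, `e ≤ M`
  have hdfacts : ∀ e : ℕ, 1 ≤ e → e ≤ M →
      (1 : ℝ) ≤ (e : ℝ) ^ 2 ∧ (e : ℝ) ^ 2 ≤ 4 * L ^ (2 / 5 * A) ∧ (e : ℝ) ≤ L ^ A := by
    intro e he heM
    have he1 : (1 : ℝ) ≤ e := by exact_mod_cast he
    have heM' : (e : ℝ) ≤ 2 * L ^ (A / 5) := le_trans (by exact_mod_cast heM) hMle
    refine ⟨by nlinarith, ?_, ?_⟩
    · have hsq : (L ^ (A / 5)) ^ 2 = L ^ (2 / 5 * A) := by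
        rw [← Real.rpow_natCast, ← Real.rpow_mul hL0.le]; ring_nf
      calc (e : ℝ) ^ 2 ≤ (2 * L ^ (A / 5)) ^ 2 := pow_le_pow_left₀ (by positivity) heM' 2
        _ = 4 * L ^ (2 / 5 * A) := by rw [mul_pow, hsq]; norm_num
    · refine heM'.trans ?_
      have h15 : 1 ≤ L ^ (A / 5) := Real.one_le_rpow hL1 (by positivity)
      have h25 : (2 : ℝ) ≤ L ^ (A / 5) := by
        calc (2 : ℝ) ≤ L := by linarith
          _ = L ^ (1 : ℝ) := (Real.rpow_one L).symm
          _ ≤ L ^ (A / 5) := hmono (by linarith)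
      calc 2 * L ^ (A / 5) ≤ L ^ (A / 5) * L ^ (A / 5) := by nlinarith
        _ = L ^ (2 / 5 * A) := by rw [← Real.rpow_add hL0]; ring_nf
        _ ≤ L ^ A := hmono (by linarith)
  have hD : 4 * L ^ (2 / 5 * A) * Wm ≤ Θ / 4 := by
    rw [hWmdef, hΘdef, le_div_iff₀ (by norm_num)]
    have e : L ^ (4 / 5 * A + 2) = L ^ (2 / 5 * A) * L ^ (2 / 5 * A + 3 / 2) * L ^ (1 / 2 : ℝ) := by
      rw [← Real.rpow_add hL0, ← Real.rpow_add hL0]; ring_nf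
    rw [e]
    have h0 : 0 ≤ L ^ (2 / 5 * A) * L ^ (2 / 5 * A + 3 / 2) := by positivity
    nlinarith
  have hDWb : 4 * L ^ (2 / 5 * A) * Wb ≤ L ^ (2 * A + 4) := by
    have e : L ^ (2 * A + 4) = L ^ (3 / 5 * A + 2) * (L ^ (2 / 5 * A) * L ^ (A + 2)) := by
      rw [← Real.rpow_add hL0, ← Real.rpow_add hL0]; ring_nf
    rw [hWbdef, e]
    have h4 : (4 : ℝ) ≤ L ^ (3 / 5 * A + 2) := by
      calc (4 : ℝ) ≤ L := by linarith
        _ = L ^ (1 : ℝ) := (Real.rpow_one L).symm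
        _ ≤ L ^ (3 / 5 * A + 2) := hmono (by linarith)
    have h0 : 0 ≤ L ^ (2 / 5 * A) * L ^ (A + 2) := by positivity
    nlinarith
  have h2Θ : 2 * Θ ≤ L ^ (4 * A) := by
    rw [hΘdef]
    have e : L ^ (4 * A) = L ^ (16 / 5 * A - 2) * L ^ (4 / 5 * A + 2) := by
      rw [← Real.rpow_add hL0]; ring_nf
    rw [e]
    have h2 : (2 : ℝ) ≤ L ^ (16 / 5 * A - 2) := by
      calc (2 : ℝ) ≤ L := by linarith
        _ = L ^ (1 : ℝ) := (Real.rpow_one L).symm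
        _ ≤ L ^ (16 / 5 * A - 2) := hmono (by linarith)
    nlinarith [hpos (4 / 5 * A + 2)]
  have hXWb : 4 * L ^ (2 / 5 * A) * Wb ≤ X := by
    refine hDWb.trans ((hmono (by linarith)).trans hXbig)
  -- `S(e²m) ↔ S(m)` for `e ≤ M`
  have hSq : ∀ e : ℕ, 1 ≤ e → e ≤ M → ∀ m : ℕ,
      lichtmanTypical X A δ (H X) (e ^ 2 * m) ↔ lichtmanTypical X A δ (H X) m := by
    intro e he heM m
    obtain ⟨-, -, heA⟩ := hdfacts e he heM
    have heW : (e : ℝ) < L ^ (33 * A) :=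
      lt_of_le_of_lt heA (Real.rpow_lt_rpow_of_exponent_lt hL1' (by linarith))
    exact lichtmanTypical_sq_mul_iff he heW (lt_of_le_of_lt heA hP2X) m
  -- `λ` is completely multiplicative with `|λ| ≤ 1`
  have hgmul : ∀ m n : ℕ, (fun n : ℕ => ((liouville n : ℤ) : ℂ)) (m * n) =
      (fun n : ℕ => ((liouville n : ℤ) : ℂ)) m * (fun n : ℕ => ((liouville n : ℤ) : ℂ)) n := by
    intro m n
    simp only [liouville_apply_mul, Int.cast_mul]
  have hgle : ∀ n : ℕ, ‖(fun n : ℕ => ((liouville n : ℤ) : ℂ)) n‖ ≤ 1 := by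
    intro n
    simp only [Complex.norm_intCast]
    exact_mod_cast abs_liouville_le_one n
  -- the per-modulus bound
  have hP : ∀ e : ℕ, 1 ≤ e → e ≤ M → ∀ β : ℝ,
      ∑ k ∈ Icc 1 X, ‖liouvilleTwistedSum ((windowDiv (e ^ 2) (H X) k).filter
          (lichtmanTypical X A δ (H X))) β‖ ≤
        (Cmaj + 600) * ((H X : ℝ) * X) * (1 / ((e : ℝ) ^ 2 * L ^ (A / 5))) := by
    intro e he heM β
    obtain ⟨hd1r, hdle, heA⟩ := hdfacts e he heM
    set d : ℕ := e ^ 2 with hddef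
    have hd1 : 1 ≤ d := Nat.one_le_pow _ _ he
    have hdreal : (d : ℝ) = (e : ℝ) ^ 2 := by rw [hddef]; push_cast; ring
    have hd0 : (0 : ℝ) < d := by rw [hdreal]; linarith
    have hdle' : (d : ℝ) ≤ 4 * L ^ (2 / 5 * A) := by rw [hdreal]; exact hdle
    have hdWm : (d : ℝ) * Wm ≤ Θ / 4 :=
      le_trans (mul_le_mul_of_nonneg_right hdle' hWm0.le) hD
    have htarget0 : 0 ≤ (H X : ℝ) * X * (1 / ((e : ℝ) ^ 2 * L ^ (A / 5))) := by positivity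
    -- reduce to `β' = fract β ∈ [0, 1]`
    have hper : ∑ k ∈ Icc 1 X, ‖liouvilleTwistedSum ((windowDiv d (H X) k).filter
          (lichtmanTypical X A δ (H X))) β‖ =
        ∑ k ∈ Icc 1 X, ‖liouvilleTwistedSum ((windowDiv d (H X) k).filter
          (lichtmanTypical X A δ (H X))) (Int.fract β)‖ := by
      simp_rw [liouvilleTwistedSum_fract]
    rw [hper]
    have hmem : Int.fract β ∈ Set.Icc (0 : ℝ) 1 := ⟨Int.fract_nonneg β, (Int.fract_lt_one β).le⟩
    rcases mem_majorArcs_or_minorArcs (W := Wm) (Q₁ := Lv) hmem with hMaj | hmin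
    · -- major arcs
      simp only [lichtmanMajorArcs, lichtmanMajorArc, Set.mem_iUnion, Set.mem_setOf_eq] at hMaj
      obtain ⟨q, ⟨hq1, hqW⟩, a, -, hθ'⟩ := hMaj
      have hq0 : (0 : ℝ) < q := by exact_mod_cast hq1
      obtain ⟨θ, hθdef⟩ : ∃ θ : ℝ, θ = Int.fract β - a / q := ⟨_, rfl⟩
      have hαθ : (a : ℝ) / q + θ = Int.fract β := by rw [hθdef]; ring
      have hθ : |θ| ≤ Θ / (q * H X) := by
        rw [hθdef]
        calc |Int.fract β - a / q| ≤ 1 / (q * Lv) := hθ'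
          _ = Θ / (q * H X) := by rw [hLvdef]; field_simp
      have hqΘ : (q : ℝ) ≤ Θ := hqW.trans hWmΘ
      have hqd : 2 * (q : ℝ) * d ≤ Wb := by
        have h1' : (q : ℝ) * d ≤ Wm * (4 * L ^ (2 / 5 * A)) :=
          mul_le_mul hqW hdle' hd0.le hWm0.le
        have h2' : Wm * (4 * L ^ (2 / 5 * A)) ≤ Θ / 4 := by rw [mul_comm]; exact hD
        have h3' : Θ ≤ Wb := by rw [hΘdef, hWbdef]; exact hmono (by linarith)
        nlinarith
      have hXWb' : (d : ℝ) * Wb ≤ X := le_trans (mul_le_mul_of_nonneg_right hdle' hWb0.le) hXWb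
      -- `S(cm) ↔ S(m)` for `c ∣ q`
      have hS : ∀ c ∈ q.divisors, ∀ m,
          lichtmanTypical X A δ (H X) (c * m) ↔ lichtmanTypical X A δ (H X) m := by
        intro c hc m
        have hc0 : c ≠ 0 := (Nat.pos_of_mem_divisors hc).ne'
        have hcW : (c : ℝ) ≤ Wm := le_trans (by exact_mod_cast Nat.divisor_le hc) hqW
        have hp : ∀ p ∈ c.primeFactors, (p : ℝ) ≤ Wm := fun p hp =>
          le_trans (by exact_mod_cast Nat.le_of_mem_primeFactors hp) hcW
        unfold lichtmanTypical
        rw [hasPrimeFactorIn_mul_iff hc0 (fun p hp' => (hp p hp').trans_lt hWmP1),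
          hasPrimeFactorIn_mul_iff hc0 (fun p hp' => (hp p hp').trans_lt hWmP2)]
      -- the mean square for the moduli `q/c`, discretised
      have h34d : ∀ c ∈ q.divisors, ∀ χ : DirichletCharacter ℂ (q / c), ∀ h : ℕ,
          (H X : ℝ) / Wb ≤ h → h ≤ H X → ∀ Y : ℕ, (X : ℝ) / (d * Wb) ≤ Y → Y ≤ X →
            ∑ k ∈ Ioc Y (2 * Y), ‖∑ m ∈ (Icc k (k + h - 1)).filter (lichtmanTypical X A δ (H X)),
                χ (m : ZMod (q / c)) * ((liouville m : ℤ) : ℂ)‖ ^ 2 ≤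
              C' * ((h : ℝ) ^ 2 * Y / Wb ^ 2) := by
        intro c hc χ h hh1 hh2 Y hY1 hY2
        have hc0 : 0 < c := Nat.pos_of_mem_divisors hc
        have hcq : c ∣ q := Nat.dvd_of_mem_divisors hc
        have hq'1 : 1 ≤ q / c := Nat.div_pos (Nat.le_of_dvd hq1 hcq) hc0
        have hq'A : ((q / c : ℕ) : ℝ) ≤ L ^ A :=
          le_trans (by exact_mod_cast Nat.div_le_self q c) (hqW.trans hWmA)
        have hh1' : (H X : ℝ) / L ^ (A + 2) ≤ h := by rwa [hWbdef] at hh1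
        have hY1' : (X : ℝ) / L ^ (2 * A + 4) ≤ (Y : ℝ) := by
          refine le_trans ?_ hY1
          apply div_le_div_of_nonneg_left hX0.le (by positivity)
          exact le_trans (mul_le_mul_of_nonneg_right hdle' hWb0.le) hDWb
        have hY2' : ((Y : ℕ) : ℝ) ≤ X := by exact_mod_cast hY2
        have hint := hCX (q / c) hq'1 hq'A χ h hh1' hh2 Y hY1' hY2'
        have hh0 : 1 ≤ h := by
          have e1 : Wb ≤ (H X : ℝ) / Wb := by
            rw [le_div_iff₀ hWb0, ← sq]; exact hWbH
          have : (1 : ℝ) ≤ h := by linarith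
          exact_mod_cast this
        have hdisc := integral_window_eq_sum_Ioc
          (fun s => ‖∑ m ∈ s.filter (lichtmanTypical X A δ (H X)),
            ((liouville m : ℤ) : ℂ) * χ (m : ZMod (q / c))‖ ^ 2) Y (2 * Y) h (by omega) hh0
        have hcast : ((2 * Y : ℕ) : ℝ) = 2 * (Y : ℝ) := by push_cast; ring
        rw [hcast] at hdisc
        rw [hdisc] at hint
        have hcomm : ∀ s : Finset ℕ, ∑ m ∈ s, χ (m : ZMod (q / c)) * ((liouville m : ℤ) : ℂ) =
            ∑ m ∈ s, ((liouville m : ℤ) : ℂ) * χ (m : ZMod (q / c)) :=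
          fun s => Finset.sum_congr rfl fun m _ => mul_comm _ _
        simp only [hcomm]
        rw [hWb2]
        exact hint.trans (mul_le_mul_of_nonneg_right hCC' (by positivity))
      have hcore := majorArc_fixed_bound_gen (X := X) (H := H X) (d := d) (q := q) (a := a)
        (θ := θ) (Θ := Θ) (Wb := Wb) (C := C') (lichtmanTypical X A δ (H X)) hX1 hd1 hq1 hqΘ hqd
        hWb4 hWbH hXWb' hθ hC'0 hS h34d
      rw [hαθ, ← hCmaj] at hcore
      simp only [liouvilleTwistedSum]
      refine hcore.trans ?_
      have e : (H X : ℝ) * X * Θ / (d * Wb) = (H X : ℝ) * X * (1 / ((e : ℝ) ^ 2 * L ^ (A / 5))) := by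
        rw [← hΘWb, hdreal]; field_simp
      rw [e, mul_assoc (Cmaj + 600)]
      exact mul_le_mul_of_nonneg_right (by linarith) htarget0
    · -- minor arcs
      have hLvdW : Lv * ((d : ℝ) * Wm) ≤ H X := by
        rw [hLvdef, div_mul_eq_mul_div, div_le_iff₀ hΘ0]
        have : (d : ℝ) * Wm ≤ Θ := by linarith
        exact mul_le_mul_of_nonneg_left this hH0.le
      have hQ₁'0 : (0 : ℝ) ≤ (H X : ℝ) / L ^ (4 * A) := by positivity
      have hQ₁'dW : 2 * ((H X : ℝ) / L ^ (4 * A)) * ((d : ℝ) * Wm) ≤ H X := by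
        have h4A0 : 0 < L ^ (4 * A) := hpos _
        have h1' : 2 * ((d : ℝ) * Wm) ≤ L ^ (4 * A) := by linarith
        calc 2 * ((H X : ℝ) / L ^ (4 * A)) * ((d : ℝ) * Wm)
            = (H X : ℝ) / L ^ (4 * A) * (2 * ((d : ℝ) * Wm)) := by ring
          _ ≤ (H X : ℝ) / L ^ (4 * A) * L ^ (4 * A) := mul_le_mul_of_nonneg_left h1' hQ₁'0
          _ = H X := div_mul_cancel₀ _ h4A0.ne'
      have hdWH : 2 * ((d : ℝ) * Wm) ≤ H X := by
        have : 2 * ((d : ℝ) * Wm) ≤ Θ := by linarith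
        exact this.trans hΘH
      have hb := minorArc_sum_le_gen (X := X) (d := d) (H := H X) (W := Wm) (P₁ := L ^ (33 * A))
        (Q₁ := Lv) (Q₁' := (H X : ℝ) / L ^ (4 * A)) (P₂ := Real.exp (L ^ (2 / 3 + δ / 2)))
        (Q₂ := Real.exp (L ^ (1 - δ / 2))) hWm2 hd1 hP₁W hLv1 hLvdW hQ₁'0 hQ₁'dW hdWH hQP h3
        hHleX (lichtmanTypical X A δ (H X)) (fun n => Iff.rfl) _ hgmul hgle hmin
      simp_rw [← liouvilleTwistedSum_eq_twistedSum] at hb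
      refine hb.trans ?_
      have hsqrt : Real.sqrt Wm = L ^ (1 / 5 * A + 3 / 4) := by
        rw [Real.sqrt_eq_rpow, hWmdef, ← Real.rpow_mul hL0.le]; ring_nf
      have hkey : Real.log (H X) / ((d : ℝ) * Real.sqrt Wm) ≤ 1 / ((e : ℝ) ^ 2 * L ^ (A / 5)) := by
        rw [hdreal, hsqrt, div_le_div_iff₀ (by positivity) (by positivity), one_mul]
        have h1' : Real.log (H X) * L ^ (A / 5) ≤ L ^ (1 / 5 * A + 3 / 4) := by
          calc Real.log (H X) * L ^ (A / 5) ≤ L ^ (2 / 3 : ℝ) * L ^ (A / 5) :=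
                mul_le_mul_of_nonneg_right hlogH (hpos _).le
            _ = L ^ (2 / 3 + A / 5) := by rw [← Real.rpow_add hL0]
            _ ≤ L ^ (1 / 5 * A + 3 / 4) := hmono (by linarith)
        calc Real.log (H X) * ((e : ℝ) ^ 2 * L ^ (A / 5))
            = (e : ℝ) ^ 2 * (Real.log (H X) * L ^ (A / 5)) := by ring
          _ ≤ (e : ℝ) ^ 2 * L ^ (1 / 5 * A + 3 / 4) := mul_le_mul_of_nonneg_left h1' (by positivity)
      calc 600 * ((H X : ℝ) * X * Real.log (H X) / (d * Real.sqrt Wm))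
          = 600 * ((H X : ℝ) * X * (Real.log (H X) / (d * Real.sqrt Wm))) := by ring
        _ ≤ 600 * ((H X : ℝ) * X * (1 / ((e : ℝ) ^ 2 * L ^ (A / 5)))) := by
            apply mul_le_mul_of_nonneg_left _ (by norm_num)
            exact mul_le_mul_of_nonneg_left hkey (by positivity)
        _ ≤ (Cmaj + 600) * ((H X : ℝ) * X) * (1 / ((e : ℝ) ^ 2 * L ^ (A / 5))) := by
            rw [mul_assoc (Cmaj + 600)]
            exact mul_le_mul_of_nonneg_right (by linarith) htarget0
  -- the integral is a finite sum over `k ≤ X`, and the fixed-`X` bound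
  rw [integral_window_eq_sum (fun s => ‖moebiusTwistedSum (s.filter (lichtmanTypical X A δ (H X))) α‖)
    X (H X) h1]
  have hmain := keyFourier_fixed_bound_M (fun e : ℕ => 1 / ((e : ℝ) ^ 2 * L ^ (A / 5)))
    (lichtmanTypical X A δ (H X)) α h1 hHleX hM1 le_rfl hP hSq
  refine hmain.trans ?_
  -- the sum over the moduli and the tail
  have hsumB : ∑ e ∈ Icc 1 M, 1 / ((e : ℝ) ^ 2 * L ^ (A / 5)) ≤ 2 * (1 / L ^ (A / 5)) := by
    have e1 : ∀ e ∈ Icc 1 M, 1 / ((e : ℝ) ^ 2 * L ^ (A / 5)) = ((e : ℝ) ^ 2)⁻¹ * (1 / L ^ (A / 5)) := by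
      intro e _; rw [one_div, mul_inv, one_div]
    rw [Finset.sum_congr rfl e1, ← Finset.sum_mul]
    refine mul_le_mul_of_nonneg_right ?_ (by positivity)
    -- `∑_{e ≤ M} e⁻² ≤ 2` (cf. `FriedlanderIwaniecPrimes.sum_Icc_inv_sq_le_two`)
    rw [← Finset.Ioc_insert_left hM1, Finset.sum_insert (by simp)]
    have h1' := sum_Ioc_inv_sq_le_sub (α := ℝ) one_ne_zero hM1
    have h2 : 0 ≤ (M : ℝ)⁻¹ := by positivity
    push_cast at h1' ⊢
    norm_num
    linarith
  have htail : 2 * ((H X : ℝ) * X) / M ≤ 2 * ((H X : ℝ) * X) * (1 / L ^ (A / 5)) := by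
    rw [mul_one_div]
    exact div_le_div_of_nonneg_left (by positivity) (hpos _) hMge
  have hHX0 : 0 ≤ (H X : ℝ) * X := by positivity
  have e : (2 * (Cmaj + 600) + 2) * ((H X : ℝ) * X / L ^ (A / 5)) =
      (Cmaj + 600) * ((H X : ℝ) * X) * (2 * (1 / L ^ (A / 5))) +
        2 * ((H X : ℝ) * X) * (1 / L ^ (A / 5)) := by
    rw [div_eq_mul_one_div]; ring
  rw [e]
  have h1' := mul_le_mul_of_nonneg_left hsumB (by positivity : 0 ≤ (Cmaj + 600) * ((H X : ℝ) * X))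
  linarith

/-- **Lichtman 2020, Theorem 2.2 AS PRINTED (`Lichtman2020_keyFourierEstimate`), conditional on exactly
Lemma 4.5 and Lemma 4.8 of the paper** (`Lichtman2020_primeCharacterSum`,
`Lichtman2020_liouvilleCharacterSifted`): all other steps are proved in the tree along the printed
set `S(X,A,δ)` with re-balanced internal parameters (module docstring; Proposition 5.1 with
`B = 2A + 4` is `dirichletMeanValue_reb`). [cite: Lichtman2020, Theorem 2.2] -/
theorem Lichtman2020_keyFourierEstimate_of_primeCharacterSum_of_liouvilleCharacterSifted
    (h45 : Lichtman2020_primeCharacterSum) (h48 : Lichtman2020_liouvilleCharacterSifted) :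
    Lichtman2020_keyFourierEstimate :=
  Lichtman2020_keyFourierEstimate_of_dirichletMeanValue_reb_of_liouvilleCharacterSifted
    (dirichletMeanValue_reb h45) h48

/-- **Lichtman 2020, Theorem 2.2 AS PRINTED, conditional on Lemma 4.5 of the paper and the
Siegel–Walfisz theorem for `μ`** (`Literature.NumberTheory.LFunctions.SiegelWalfiszMoebius`), Lemma
4.8 being the tree's `Lichtman2020_liouvilleCharacterSifted_of_siegelWalfiszMoebius`.
[cite: Lichtman2020, Theorem 2.2] -/
theorem Lichtman2020_keyFourierEstimate_of_primeCharacterSum_of_siegelWalfiszMoebius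
    (h45 : Lichtman2020_primeCharacterSum)
    (hSW : Literature.NumberTheory.LFunctions.SiegelWalfiszMoebius) :
    Lichtman2020_keyFourierEstimate :=
  Lichtman2020_keyFourierEstimate_of_primeCharacterSum_of_liouvilleCharacterSifted h45
    (Lichtman2020_liouvilleCharacterSifted_of_siegelWalfiszMoebius hSW)

/-- **Proposition 3.4 along the printed set, re-balanced, from Lemma 4.5 and Lemma 4.8** (the
composition of `liouvilleMeanSquare_reb_of` with `dirichletMeanValue_reb`).
[cite: Lichtman2020, Proposition 3.4] -/
theorem Lichtman2020.liouvilleMeanSquare_reb (h45 : Lichtman2020_primeCharacterSum)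
    (h48 : Lichtman2020_liouvilleCharacterSifted) :
    ∀ A : ℝ, 5 < A → ∀ δ : ℝ, 0 < δ → ∀ H : ℕ → ℕ,
    Tendsto (fun X : ℕ => Real.log (H X) / Real.log (Real.log X)) atTop atTop →
    (∀ᶠ X : ℕ in atTop, (H X : ℝ) ≤ Real.exp (Real.log X ^ (2 / 3 : ℝ))) →
    ∃ C : ℝ, ∀ᶠ X : ℕ in atTop, ∀ q : ℕ, 1 ≤ q → (q : ℝ) ≤ Real.log X ^ A →
      ∀ χ : DirichletCharacter ℂ q, ∀ h : ℕ,
        (H X : ℝ) / Real.log X ^ (A + 2) ≤ h → h ≤ H X →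
        ∀ Y : ℝ, (X : ℝ) / Real.log X ^ (2 * A + 4) ≤ Y → Y ≤ X →
          ∫ x in Y..2 * Y,
              ‖∑ m ∈ (Icc ⌈x⌉₊ ⌊x + h⌋₊).filter (lichtmanTypical X A δ (H X)),
                  ((liouville m : ℤ) : ℂ) * χ (m : ZMod q)‖ ^ 2
            ≤ C * ((h : ℝ) ^ 2 * Y / Real.log X ^ (2 * A + 4)) :=
  liouvilleMeanSquare_reb_of (dirichletMeanValue_reb h45) h48

end Literature.NumberTheory.Sieve
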